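import Literature.MathematicalPhysics.QuantumFieldTheory.Balaban1983to89.B9SectDERandomWalkClauses
import Literature.MathematicalPhysics.QuantumFieldTheory.Balaban1983to89.B9Thm314

/-!
# `Balaban1983to89.B9Carve10Thm312toAppCHyp` — [Balaban1985BackgroundPropagators] pp. 423–434 (Theorems 3.12–3.15, the
# projection 𝔓 and the propagator 𝔊, Sect. E «Unit Lattice Propagators», the Appendix): P6 CARVING FAN block 10 — the
# section's printed statements CONJOINED BY NAME over the carriers of `…Balaban1983to89.B9`, plus the three residual printed
# statements of these pages that had no declaration (hypothesis form); ONE bundle `B9Carve10Thm312toAppCHyp` keyed to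
# `stmt-QuantumFields-20542` (also feeds 19200)

statement-level skeleton of published theorems with citation tags; proofs where landed; nothing here is a claim about the
Yang–Mills mass gap

SOURCE.  T. Bałaban, *Propagators for lattice gauge theories in a background field*, Commun. Math. Phys. **99** (1985) 389–434
[Balaban1985BackgroundPropagators] (cell paper B9; held `paper:balaban1985-cmp99-background-propagators`, journal page = PDF page
+ 388).  Pages 423–433 [PDF 35–45] READ AS IMAGES by this seat (renders `pub/pub-balaban/b2b-balaban-ref1/pages/
1985-cmp99-background-propagators/…-p035-x2.png` … `…-p045-x2.png`, 2026-08-28); page:line locators `pNNNN.txt:L<n>` refer to the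
`lit read` text layer (NNNN = PDF page).  Cell `lit-balaban`, unit `lit-balaban-carve-10` (D-0154 (3b), `carve/BLOCKS-01-10.md` row 10,
`carve/CARVE-RULES.md`); KEY item `stmt-QuantumFields-20542` (K1⁷, consumer lane N06 [B9]); also feeds `stmt-QuantumFields-19200`.
No summit statement is proved by this file; it moves no node count.

IN TREE = CITED, NEVER RESTATED (CARVE-RULES §2.3).  The 17 SKELETON rows of this block all have declarations; they are used BY
NAME below or, where they are PROVED identities rather than statements, listed here and nowhere re-typed:
* B9.Thm3.12 (p. 423) → `B9.Thm312Printed` (with `B9.Ineq342_346_347_noLap`, `B9.Ineq343_345`, `B9.Ineq3133`, `B9.HKernel`,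
  `B9.Stmt3132Printed`, `B9.Ineq3132`); its Theorem-3.10 clauses → `B9SectDERandomWalkClauses.Thm312RWPrinted`; the proof
  (3.130)/(3.138) → `B9Eq3130Neumann.eq3138_*`, `B9SectDSup`, `B9SectDL2Decay.thm312_entry_l2` (row B9.Eq3.138),
  `B9Eq3138FirstFactors` (the displayed three-line estimate of p. 423), `B9Eq3138StepDelta2Pi`, `B9Delta2PiMajorant`,
  `B9Thm312Positivity(Assembled)` («Theorem 3.11 holds for G, G₁»), the pinned leaf `B9Thm312Whole*`.
* B9.Thm3.13 (p. 426) → `B9.Thm313Printed`, `B9SectDERandomWalkClauses.Thm313RWPrinted`; rows B9.Eq3.139 / B9.Eq3.148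
  ((3.139)–(3.153), pp. 424–426: 𝔓 as the ⟨·,G₁⁻¹·⟩-orthogonal projection onto {QA = 0, RD*A = 0}, (3.140), (3.142)–(3.147),
  Q𝔓 = 0, RD*𝔓 = 0, 𝔓² = 𝔓, 𝔓^{[*]} = 𝔓, range 𝔓; 𝔊 of (3.148), (3.149)–(3.153), R = Δ𝒢Δ, 𝒢 = G′² − G′²Q′*(Q′G′²Q′*)⁻¹Q′G′²,
  Q′𝒢 = 𝒢Q′* = 0, (3.151)–(3.152), «these identities imply (3.124)», «RD*G₁DR = R») → PROVED: `B9Eq3147.eq_3139_min`,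
  `eq_3140`, `eq_3142_min`, `eq_3143`, `eq_3145`, `eq_3146`, `eq_3147`, `Qb_mul_frakP`, `dcon_mul_frakP`, `frakP_mul_frakP`,
  `frakP_bracketAdjoint`, `range_frakP`, `eq_3148`, `eq_3149`, `eq_3150`, `eq_3153`; `B9.frakP_of_3146`, `B9.q_mul_frakP`,
  `B9.rds_mul_frakP`, `B9.frakP_idem`, `B9.frakG_3150`, `B9.frakG_3153`; `B9SectECov.R_eq_226`, `eq_3172`, §9;
  `B9Eq3152.sectD_hypotheses`; the reduction sentence of p. 426 («(3.147), (3.153) permit us to reduce properties of 𝔓, 𝔊 …»)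
  → `B9Thm313RightEntries`; the TRUE positivity reading of «Theorem 3.11 holds for 𝔊» → `B9FrakGPos`.
* B9.Thm3.14 (pp. 426–427) → `B9.Thm314Printed`, `B9Thm314.Thm314LocalPrinted` (the printed localisation y, y′ ∈ Ω^{(k)}, all
  local inequalities; proof sketch p. 427 as named leaves `B9Thm314.DiffExpansionPrinted`, …, `thm314Printed_of_leaves`),
  `B9SectDERandomWalkClauses.Thm314CinvPrinted` / `Thm314SectDKernelsPrinted` (the kernels and H-operators); row B9.Eq3.154 →
  the parameter `dOmega`, `B9.dOmega_le_walk_add`; the p. 427 remark on TREE-LIKE walks for G₁, H₁ is a property of the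
  INSTANCE of `B9.RWExpansion` (reading note (i) of `B9SectDERandomWalkClauses`), not a further statement.
* Sect. E (pp. 427–432): rows B9.Eq3.155 ((3.155)–(3.158)) → `B9SectECov.genFun_eq`, `eq_3157`, `eq_3158`; the γ₀ sentence of
  p. 428 → `B9SectDERandomWalkClauses.ClaimP428GammaZeroPrinted` (repair logic `B9SectEKernel.gamma0_assembly`); «This property,
  together with a uniform exponential decay of C*Δ_kC implies bounds and uniform exponential decay for C̃^{(k)}(Λ) … by the theorem
  of Sect. 5 in [2]» (p. 428, p0040.txt:L26–29) → PROVED abstractly: `QGQInverse.inverse_decay`, `B9SectEKernel.resolvent_decay_uniform`;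
  B9.Eq3.159 ((3.159)–(3.161)) → `B9Eq3112.eq_3159`, `B9Eq3166.eq_3160`; B9.Eq3.162 ((3.162)–(3.164), «λ₀ is determined uniquely by
  the two conditions», «the operator on the right-hand side of (3.163) is equal to the operator H′») → `B9H163.H163`, `Hmin`,
  `H163_eq_Hmin`, `unique_of_conditions`; B9.Eq3.165 ((3.165)–(3.170), «the δ-functions above determine μ uniquely as a linear
  function of B» (3.169)) → `B9Eq3166.eq_3165_constraint`, `eq_3166`, `B9Eq3169Mu.mu`, `mu_unique'`; B9.Eq3.171 ((3.171)–(3.176))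
  → `B9SectECov` §7–§8 (`eq_3172`, `eq_3173_fibre`, `eq_3175`), `B9Eq3184.eq_3176`; B9.Eq3.177 ((3.177)–(3.182)) →
  `B9Eq3184.eq_3177` … `eq_3182` (the printed sign of (3.182) is REFUTED there: `eq_3182_printed_fails`); B9.Eq3.183 ((3.183)–(3.184))
  → `B9Eq3183.eq_3183_print`, `B9Eq3184.lamT`, `config_3183`; B9.Eq3.185 ((3.185)–(3.186)) → `B9Eq3185.eq_3185`, `eq_3185_via_G2`,
  `B9SectECov` (3.186); the undisplayed sentence after (3.186) («The operator G₂ differs from G₁ only by the small and regular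
  operators … we can investigate the operator G₂ perturbatively in the same way as the operator G₁ in (3.138)», p. 432) →
  `B9Eq3186G2Perturbation.g2_of_letters`; «The formula (3.185) implies immediately bounds and an exponential decay» →
  `B9Thm315Decay.thm315Printed_of_3185`.
* B9.Thm3.15 (p. 432) → `B9.Thm315Printed`, `B9.Thm315FullPrinted` (`B9.thm315_bound_of_full`),
  `B9SectDERandomWalkClauses.Thm315RWCorePrinted` (verbatim core of the expansion clause) / `Thm315RWExpansionPrinted` (its reading
  with the (3.99)-pattern per-term bound) / `Thm315RWExpansionLargeMPrinted`; the pinned leaf `B9Thm315Whole*`.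
* B9.App (Appendix pp. 432–433, (3.188)–(3.193)) → PROVED/TYPED: `B9AppChiral.bondU`, `chiralAction`, `wil_bondU_rev`, `Jb` (3.190),
  `deltaPrimeCh` (3.192), `hessCh` (3.191), `eq3189` ((3.189) as an exact second-order identity), `Qj` (3.193).  NOT TYPED, here or
  there, with the reason of record (`B9AppChiral` module docstring): (3.194) «Q_j(U)A = Q′_jA + F_{2,j}(U)A, where the operator
  F_{2,j}(U) is small», p. 433 «Δ′^η(U) is a first order differential operator with sufficiently small coefficients» and the closing
  by-reference sentence «all the results of these two papers [2, 4] hold for the operator G(U) = (Δ^η_a(U))⁻¹ … We refer the reader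
  to the two papers for precise formulations» — qualitative smallness / by-reference remarks with no printed constant or statement;
  the Appendix states no theorem and has no consumer among the keyed items.

THE RESIDUAL PRINTED STATEMENTS OF pp. 423–433 WITH NO DECLARATION (searched 2026-08-28: `rg` over `Balaban1983to89/B9*.lean` for
«common, best possible», «regular function», «DΔH», «almost local», «identity operator on almost all bonds»; r06's `ROWS-B9.md`;
`EXISTING-DECLS.tsv`) — typed here in hypothesis form (§2):
(N1) pp. 423–424 (p0035.txt:L29–31, p0036.txt:L1–3) the COMMON-CONSTANTS clause «Let us denote a common, best possible, decay rate
     for all these operators by δ₀. It is a positive, absolute constant depending on d and L only. Similarly, let us denote common,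
     best possible constants on the right-hand sides of the inequalities for these operators, with all possible norms, either by B₀,
     or by B₀ with parameters indicating a dependence on Hölder norms. These constants also depend on d and L only, or on the
     indicated parameters additionally.» → `CommonConstantsPrinted` (recorded before only as a docstring remark, D-r1.2 of `B9.lean`).
(N2) p. 431 (p0043.txt:L15–16), after (3.177): «hence ΔH′μ is a regular function, more exactly, DΔH′μ is bounded, and even Hölder
     norms are bounded.» → `Remark3177RegularPrinted` (`B9Eq3184` certifies (3.177) and records this clause as NOT certified;
     `B9Eq3186G2Perturbation` consumes an H′-letter of this kind as a hypothesis).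
(N3) p. 428 (p0040.txt:L16–17) the ALMOST-LOCALITY of the parametrization operator C of B = CB̃: «This implies that the operator
     C is almost local, a value (CB̃)(b) depends on B̃ restricted to several blocks surrounding the bond b.» →
     `Remark428CAlmostLocalPrinted`.  The operator C itself and the rest of that paragraph — «an identity operator on almost all
     bonds, except the bonds b₀ for which a value (CB̃)(b₀) is equal to a solution of the equation (QB)(c) = 0, considered as an
     equation on the variable B(b₀)», «we can parametrize this subspace» — are IN TREE as a definition with PROVED properties:
     `Beta.ConstraintElimination.elim` (C = [1 ; −Q_κ⁻¹Q_σ] in adapted coordinates), `elim_mulVec_inl`, `constraint_mulVec_elim`,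
     `elim_unique` (and `B10Eq61EliminationTerms.Q_mul_elimMatrix`, `elimMatrix_mulVec_injective`; `B9SectECov` carries C as an
     abstract matrix with left inverse χ) — cited, not restated.
By-name USES of existing declarations for printed sentences that needed no new definition: p. 426 «Especially for 𝔊 we have,
assuming (3.132)» → `B9.Stmt3132Printed`; p. 431 (p0043.txt:L8) «(3.174) … It implies all properties of C′^{(k)}(Λ), especially a
random walk expansion» → `B9SectDERandomWalkClauses.Thm315RWCorePrinted` instantiated at the designated kernel expansion `ECp` of
C′^{(k)}(Λ) (its body is generic in the expansion; docstring there names C^{(k)}(Λ)).  CONVENTIONS OF RECORD carried, not re-typed: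
the standing hypotheses «two sequences of domains {Ω_j}, {Ω′_j}, both satisfying the conditions (2.1)–(2.4) in [4], with M and R
sufficiently large» (p. 426) and «Λ ⊂ Λ_k = Ω_k^{(k)}, Λ is a union of big blocks, and a distance between Λ and Λ_kᶜ is bigger than
RM» (p. 427) are absorbed into the family index i ∋ (torus, k, {Ω_j}, Λ, M) exactly as in `B9.Thm315Printed`,
`B9SectDERandomWalkClauses.Thm314CinvPrinted` (ref-2 g138 §C-2).

WHAT IS DECLARED.  §1 three LETTER RECORDS (parameter records, nothing constructed, no instances): `HPrimeLetters` (the quantities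
of (N2) at one member), `ParamCLetters` (the objects of (N3) at one member), `Letters` (every operator family / predicate slot /
expansion the block's statements quantify over, as functions of the member i).  §2 the three residual statements (N1)–(N3) as
`def …Printed : Prop` with explicit binders.  §3 THE BUNDLE `B9Carve10Thm312toAppCHyp d c35 geo bg 𝔩 : Prop` = the conjunction,
BY NAME, of: (N1); Theorem 3.12 (`B9.Thm312Printed`) with (3.132) (`B9.Stmt3132Printed`) and its random-walk clauses
(`Thm312RWPrinted`); Theorem 3.13 (`B9.Thm313Printed`, `Thm313RWPrinted`); Theorem 3.14 for every kernel-family-type operator of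
the member (`B9Thm314.Thm314LocalPrinted`, indexed by `𝔩.T` = «G′, G, G₁, 𝔊, …»), for (Q′G′²Q′*)⁻¹ (`Thm314CinvPrinted`) and for
(QGQ*)⁻¹, (QG₁Q*)⁻¹, H, H₁ (`Thm314SectDKernelsPrinted`); (N3); the γ₀ sentence (`ClaimP428GammaZeroPrinted`); the C′^{(k)}(Λ)
expansion sentence (`Thm315RWCorePrinted` at `ECp`); (N2); Theorem 3.15 in full (`B9.Thm315FullPrinted`) with the verbatim core of
its expansion clause (`Thm315RWCorePrinted` at `EC`).  v1 (p607801) = §§1–3, STATEMENTS ONLY; v1.1 (this file, APPEND-ONLY: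
every v1 declaration byte-identical) adds §4, the kernel-checked BOOKKEEPING — the projections of the bundle (dot notation
`h.thm312`, …, `h.thm315` via `B9.thm315_bound_of_full`, `h.thm314_r1` via `B9Thm314.thm314Printed_iff_supOn_univ`) and the one
non-trivial consequence, (N1) IMPLIES r1's separately quantified Theorems 3.1, 3.2, 3.3 and the statement (3.132)
(`CommonConstantsPrinted.thm31/.thm32/.thm31and32/.thm33/.stmt3132/.sectD_blocks`: the common-constants clause is STRONGER than the
conjunction of the typed theorems, as print intends); theorems only, 0 sorry.  v1.2 (APPEND-ONLY) adds §5 on check-5's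
PASS-WITH-NOTES of record (`carve/CHECK-5.md` 2026-08-28T06:09:30Z): the fan's alias `B9Carve10Thm312toAppCHyp.Hyp` for the bundle
(N-c5-1; `hyp_iff`, `Hyp.thm312`, `Hyp.thm315Full`) and the uniform-radius variant `Remark428CAlmostLocalUniformPrinted` of (N3) (N-c5-5;
`almostLocal_of_uniform`, `uniform_of_almostLocal`).
HONEST SCOPE.  Hypothesis-form typing over EXISTING carriers; nothing of the paper is asserted; every `…Printed` is consumed only as
`(h : …)`; the rate convention for the H-kernels inside (N1) is that of `B9.Thm312Printed` (`B9.Ineq3133` read at δ₁ := δ₀, i.e.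
e^{−½δ₀d}); the GAPS rows of the cited declarations (G-B9-08/09/10/11/15/16/19) travel with their names.  0 sorry, no instance, no
notation.  Value = typed skeleton; NOT summit progress.
-/

namespace Literature.MathematicalPhysics.QuantumFieldTheory.Balaban1983to89

namespace B9Carve10Thm312toAppCHyp

open B9 B9SectDERandomWalkClauses B9Thm314

/-! ## §1 Letter records (parameters only; nothing constructed) -/

/-- THE QUANTITIES OF THE p. 431 REGULARITY REMARK AT ONE MEMBER (letters of (N2), nothing constructed): `CoarseFn` = the
functions μ on the unit lattice Λ ⊂ T₁^{(k)} on which the translation operator H′ of (3.163)/(3.164) acts; `coarseSup μ` = |μ|;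
`supD U μ` = sup_b |(DΔH′μ)(b)| and `holderD U α μ` = the Hölder norm ‖DΔH′μ‖_α of the bond function DΔH′μ, for the background U
(H′ = H′(U) through G′(U), Q′(U) in (3.163)).  A parameter record: the file never identifies these functionals.
[cite: Balaban1985BackgroundPropagators, (3.177) p.431] -/
structure HPrimeLetters (B : Backgrounds) where
  CoarseFn : Type
  coarseSup : CoarseFn → ℝ
  supD : B.Cfg → CoarseFn → ℝ
  holderD : B.Cfg → ℝ → CoarseFn → ℝ

/-- THE OBJECTS OF THE p. 428 ALMOST-LOCALITY SENTENCE AT ONE MEMBER (letters of (N3), nothing constructed; 𝔤-valued bond variables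
read as real variables with the colour index absorbed into the bond index, the convention of `B9SectECov`/`B9Eq3184`): `Bond` = the
bonds of Λ carrying the variables B of (3.155), `Var` = the bonds of Λ̃ = Λ∖(⋃_{y∈Λ′}Ax(y) ∪ ⋃_{c∈Λ′}B(c)∩c) carrying B̃, `Cop U` =
the linear operator C of «B = CB̃» at the background U (it depends on U through the averaging Q = Q(Ū^k) in «(QB)(c) = 0»; its
DEFINITION and algebra are the tree's `Beta.ConstraintElimination.elim`, `elim_mulVec_inl`, `constraint_mulVec_elim`, `elim_unique`
in adapted coordinates — the intended reading of `Cop` is that matrix on the member's bond index), `near b v` = «the B̃-variable v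
lies in one of the several blocks surrounding the bond b» (print gives no radius; the neighbourhood is a letter).
[cite: Balaban1985BackgroundPropagators, p.428 (after (3.156))] -/
structure ParamCLetters (B : Backgrounds) where
  Bond : Type
  Var : Type
  near : Bond → Var → Prop
  Cop : B.Cfg → (Var → ℝ) →ₗ[ℝ] (Bond → ℝ)

/-- THE LETTERS OF BLOCK 10 AS FUNCTIONS OF THE MEMBER i (a parameter record over the carriers of `…Balaban1983to89.B9`; nothing
constructed, no field is ever identified by this file).  Operator families seen through the printed quantities: `Gp` = G′ (Thm 3.1),
`GA` = the Sect. A–C operator G = Δ_a⁻¹ (Thm 3.3; renamed G₀ at (3.130)), `GD` = Sect. D's G = (Δ_π + DRD* + Q*aQ)⁻¹ (3.122),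
`G₁` (3.128), `GG` = 𝔊 (3.148)/(3.153) (`B9.KernelFamily`); `Cinv` = (Q′G′²Q′*)⁻¹ (3.48), `QGQinv` = (QGQ*)⁻¹, `QG₁Qinv` =
(QG₁Q*)⁻¹ (3.132) (`B9.SiteKernel`); `H` = GQ*(QGQ*)⁻¹ (3.126), `H₁` (3.129) (`B9.HKernel`); the abstract slots of r1's
`B9.Thm312Printed`/`Thm313Printed` (`HasRWExp`, `HasRWExpH`, `PosDefK`); the designated random-walk expansions of G, G₁, 𝔊 with
their walk-indexed term families (`ED`, `E₁`, `EG`, `termD`, `term₁`, `termG`; tree-like ω, p. 427) and the kernel expansions of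
H, H₁ (`EH`, `EH₁`, `termH`, `termH₁`); Theorem 3.14's data: an index type `T` of the kernel-family-type operators of the member
(«G′, G, G₁, 𝔊, …») with their DIFFERENCES for the two sequences `Kdiff t`, the differences `Cdiff` ((Q′G′²Q′*)⁻¹), `Qdiff`,
`Q₁diff` ((QGQ*)⁻¹, (QG₁Q*)⁻¹), `Hdiff`, `H₁diff`, the localisation predicate `OmK` (y ∈ Ω^{(k)}) and `dOmega` (3.154); Sect. E:
the kernel `Ck` of C^{(k)}(Λ) on the sites `inΛ` of Λ with the unit-lattice distance `unitDist`, the slots `GivenBy3185`,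
`HasRWExpC` of r1's `B9.Thm315FullPrinted`, the designated kernel expansions `EC` of C^{(k)}(Λ) and `ECp` of C′^{(k)}(Λ) (3.174),
the coercivity slot `Coercive` of the γ₀ sentence, the letters `paramC` of (N3) and `hprime` of (N2).
[cite: Balaban1985BackgroundPropagators, Thms 3.12–3.15 pp.423–432] -/
structure Letters {I : Type} (geo : I → Geometry) (bg : I → Backgrounds) where
  Gp : ∀ i, KernelFamily (geo i) (bg i)
  GA : ∀ i, KernelFamily (geo i) (bg i)
  GD : ∀ i, KernelFamily (geo i) (bg i)
  G₁ : ∀ i, KernelFamily (geo i) (bg i)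
  GG : ∀ i, KernelFamily (geo i) (bg i)
  Cinv : ∀ i, SiteKernel (geo i) (bg i)
  QGQinv : ∀ i, SiteKernel (geo i) (bg i)
  QG₁Qinv : ∀ i, SiteKernel (geo i) (bg i)
  H : ∀ i, HKernel (geo i) (bg i)
  H₁ : ∀ i, HKernel (geo i) (bg i)
  HasRWExp : ∀ i, KernelFamily (geo i) (bg i) → (bg i).Cfg → ℝ → Prop
  HasRWExpH : ∀ i, HKernel (geo i) (bg i) → (bg i).Cfg → ℝ → Prop
  PosDefK : ∀ i, KernelFamily (geo i) (bg i) → (bg i).Cfg → Prop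
  ED : ∀ i, RWExpansion (geo i) (bg i)
  E₁ : ∀ i, RWExpansion (geo i) (bg i)
  EG : ∀ i, RWExpansion (geo i) (bg i)
  termD : ∀ i, (ED i).Walk → KernelFamily (geo i) (bg i)
  term₁ : ∀ i, (E₁ i).Walk → KernelFamily (geo i) (bg i)
  termG : ∀ i, (EG i).Walk → KernelFamily (geo i) (bg i)
  EH : ∀ i, RWKernelExpansion (geo i) (bg i)
  EH₁ : ∀ i, RWKernelExpansion (geo i) (bg i)
  termH : ∀ i, (EH i).Walk → HKernel (geo i) (bg i)
  termH₁ : ∀ i, (EH₁ i).Walk → HKernel (geo i) (bg i)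
  T : Type
  Kdiff : T → ∀ i, KernelFamily (geo i) (bg i)
  Cdiff : ∀ i, SiteKernel (geo i) (bg i)
  Qdiff : ∀ i, SiteKernel (geo i) (bg i)
  Q₁diff : ∀ i, SiteKernel (geo i) (bg i)
  Hdiff : ∀ i, HKernel (geo i) (bg i)
  H₁diff : ∀ i, HKernel (geo i) (bg i)
  OmK : ∀ i, (geo i).Site → Prop
  dOmega : ∀ i, (geo i).Site → (geo i).Site → ℝ
  Ck : ∀ i, SiteKernel (geo i) (bg i)
  inΛ : ∀ i, (geo i).Site → Prop
  unitDist : ∀ i, (geo i).Site → (geo i).Site → ℝ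
  GivenBy3185 : ∀ i, (bg i).Cfg → Prop
  HasRWExpC : ∀ i, (bg i).Cfg → ℝ → Prop
  EC : ∀ i, RWKernelExpansion (geo i) (bg i)
  ECp : ∀ i, RWKernelExpansion (geo i) (bg i)
  Coercive : ∀ i, (bg i).Cfg → ℝ → Prop
  paramC : ∀ i, ParamCLetters (bg i)
  hprime : ∀ i, HPrimeLetters (bg i)

/-! ## §2 The residual printed statements of pp. 423–433 (hypothesis form) -/

/-- **(N1) THE COMMON-CONSTANTS CLAUSE OF pp. 423–424** [PDF 35–36] (p0035.txt:L29–31, p0036.txt:L1–3; immediately after Theorem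
3.12), verbatim: «Let us denote a common, best possible, decay rate for all these operators by δ₀. It is a positive, absolute
constant depending on d and L only. Similarly, let us denote common, best possible constants on the right-hand sides of the
inequalities for these operators, with all possible norms, either by B₀, or by B₀ with parameters indicating a dependence on Hölder
norms. These constants also depend on d and L only, or on the indicated parameters additionally.»  TYPED: ONE rate δ₀ > 0, ONE
constant B₀ > 0 and ONE family B₀(β), B′₀(ε), B′₀(ε, β) (`Bβ`, `Bε`, `Bεβ`), together with one M-threshold and one smallness
threshold a₀ (inherited from Theorems 3.1 and 3.12, «M sufficiently large», «Mα₀ ≤ a₀»), quantified BEFORE the member i (=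
«depending on d and L only») and serving SIMULTANEOUSLY, in the blocks of record and never restated: under (3.35) — G′ (Theorem
3.1: `B9.Ineq342_346_347`, `B9.Ineq343_345`), (Q′G′²Q′*)⁻¹ (Theorem 3.2, the (3.48) shape of `B9.Thm32Printed`), the Sect. A–C
operator G (Theorem 3.3); under (3.35) and (3.36) — Sect. D's G and G₁ (Theorem 3.12: `B9.Ineq342_346_347_noLap`, the exception
being the covariant-Laplacian entry of (3.42), and `B9.Ineq343_345`), H and H₁ ((3.133), `B9.Ineq3133`, rate convention of
`B9.Thm312Printed`: δ₁ := δ₀), (QGQ*)⁻¹ and (QG₁Q*)⁻¹ ((3.132), `B9.Ineq3132`, δ₁ := δ₀).  SCOPE (reading): «all these operators»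
= the operators constructed up to this sentence (Sects. A–D); 𝔓, 𝔊 are introduced after it (p. 424 «Finally let us introduce two
other important operators») and Theorem 3.13's constants stay those of `B9.Thm313Printed`.  STRONGER than the conjunction of the
separately typed theorems, as print intends (v1.1 §4: `CommonConstantsPrinted.thm31`, `.thm32`, `.thm33`, `.stmt3132`).
[cite: Balaban1985BackgroundPropagators, pp.423–424 (after Thm 3.12); Thm 3.1 (3.42)–(3.47) pp.397–398; Thm 3.2 (3.48) p.398; Thm 3.3 p.399; (3.132)–(3.133) p.422; Thm 3.12 p.423] -/
def CommonConstantsPrinted {I : Type} (d : ℕ) (c35 : ℝ) (geo : I → Geometry) (bg : I → Backgrounds)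
    (Gp GA GD G₁ : ∀ i, KernelFamily (geo i) (bg i)) (Cinv QGQinv QG₁Qinv : ∀ i, SiteKernel (geo i) (bg i))
    (H H₁ : ∀ i, HKernel (geo i) (bg i)) : Prop :=
  ∃ M₀ δ₀ a₀ B₀ : ℝ, ∃ Bβ Bε : ℝ → ℝ, ∃ Bεβ : ℝ → ℝ → ℝ, 0 < M₀ ∧ 0 < δ₀ ∧ 0 < a₀ ∧ 0 < B₀ ∧
    ∀ i : I, M₀ ≤ (geo i).M → ∀ α₀ : ℝ, 0 < α₀ → (geo i).M * α₀ ≤ a₀ →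
      ∀ U : (bg i).Cfg, (bg i).Reg335 c35 α₀ U →
        ((Ineq342_346_347 (Gp i) B₀ δ₀ U ∧ Ineq343_345 (Gp i) Bβ Bε Bεβ δ₀ U) ∧
          (∀ y y' : (geo i).Site, |(Cinv i).ker U y y'| ≤
            B₀ * ((geo i).len y) ^ (-(4 : ℝ)) * ((geo i).len y') ^ (-(d : ℝ)) *
              Real.exp (-(δ₀ * (geo i).dist y y'))) ∧
          (Ineq342_346_347 (GA i) B₀ δ₀ U ∧ Ineq343_345 (GA i) Bβ Bε Bεβ δ₀ U)) ∧
        ((bg i).Reg336 c35 α₀ U →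
          (Ineq342_346_347_noLap (GD i) B₀ δ₀ U ∧ Ineq343_345 (GD i) Bβ Bε Bεβ δ₀ U) ∧
          (Ineq342_346_347_noLap (G₁ i) B₀ δ₀ U ∧ Ineq343_345 (G₁ i) Bβ Bε Bεβ δ₀ U) ∧
          (Ineq3133 d (H i) B₀ Bβ δ₀ U ∧ Ineq3133 d (H₁ i) B₀ Bβ δ₀ U) ∧
          (Ineq3132 d (QGQinv i) B₀ δ₀ U ∧ Ineq3132 d (QG₁Qinv i) B₀ δ₀ U))

/-- **(N2) THE REGULARITY REMARK AFTER (3.177)**, p. 431 [PDF 43] (p0043.txt:L15–16), verbatim with its display: «Let us notice that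
by (3.163) we have ΔH′μ = G′Q′*(Q′G′²Q′*)⁻¹(μ − aQ′G′Q′*μ), (3.177) hence ΔH′μ is a regular function, more exactly, DΔH′μ is bounded,
and even Hölder norms are bounded.» (used on p. 432: «the new terms are more regular, as it follows easily from (3.184)»; H′ =
(3.163)/(3.164) is `B9H163.H163`, the identity (3.177) is `B9Eq3184.eq_3177` — PROVED; the boundedness clause is the part with no
declaration).  TYPED (READING, every choice named): «DΔH′μ is bounded» ↦ the operator μ ↦ DΔH′μ is bounded from the sup norm of μ,
`supD U μ ≤ C·|μ|`; «even Hölder norms are bounded» ↦ `holderD U α μ ≤ C(α)·|μ|` for Hölder exponents 0 ≤ α < 1 (the range of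
(3.43)); constants C, C(·) and the thresholds BEFORE the member i and U (the standing convention (N1) of pp. 423–424, «depend on d
and L only, or on the indicated parameters»); hypotheses = those under which G′, (Q′G′²Q′*)⁻¹ in (3.177) carry their bounds
(Theorems 3.1–3.2: M ≥ M₁, (3.35), Mα₀ ≤ a₀).  The print displays no inequality for this clause; nothing sharper is typed.
[cite: Balaban1985BackgroundPropagators, (3.177) p.431] -/
def Remark3177RegularPrinted {I : Type} (c35 : ℝ) (geo : I → Geometry) (bg : I → Backgrounds)
    (hp : ∀ i, HPrimeLetters (bg i)) : Prop :=
  ∃ M₁ a₀ C : ℝ, ∃ Cα : ℝ → ℝ, 0 < M₁ ∧ 0 < a₀ ∧ 0 < C ∧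
    ∀ i : I, M₁ ≤ (geo i).M → ∀ α₀ : ℝ, 0 < α₀ → (geo i).M * α₀ ≤ a₀ →
      ∀ U : (bg i).Cfg, (bg i).Reg335 c35 α₀ U →
        ∀ μ : (hp i).CoarseFn,
          (hp i).supD U μ ≤ C * (hp i).coarseSup μ ∧
          ∀ α : ℝ, 0 ≤ α → α < 1 → (hp i).holderD U α μ ≤ Cα α * (hp i).coarseSup μ

/-- **(N3) THE ALMOST-LOCALITY OF C, p. 428** [PDF 40] (p0040.txt:L16–17).  Context, verbatim: «Variables B depend linearly on B̃
and we have B = CB̃, where C is a linear operator. It is an identity operator on almost all bonds, except the bonds b₀ for which a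
value (CB̃)(b₀) is equal to a solution of the equation (QB)(c) = 0, considered as an equation on the variable B(b₀).» — IN TREE as
`Beta.ConstraintElimination.elim` with `elim_mulVec_inl`, `constraint_mulVec_elim`, `elim_unique` (PROVED; cited, not restated).  The
sentence typed here is the next one, which has no declaration: «This implies that the operator C is almost local, a value (CB̃)(b)
depends on B̃ restricted to several blocks surrounding the bond b.»  TYPED over the letters `ParamCLetters` at every member i and
background U: if two variable configurations B̃₁, B̃₂ agree on the neighbourhood `near b` of the bond b, then (CB̃₁)(b) = (CB̃₂)(b)
(READING of «several blocks surrounding the bond b»: the neighbourhood is a letter of the member).  No hypothesis on U is printed for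
this sentence and none is typed. [cite: Balaban1985BackgroundPropagators, p.428 (after (3.156))] -/
def Remark428CAlmostLocalPrinted {I : Type} (bg : I → Backgrounds) (pc : ∀ i, ParamCLetters (bg i)) : Prop :=
  ∀ i : I, ∀ U : (bg i).Cfg, ∀ (b : (pc i).Bond) (Bt₁ Bt₂ : (pc i).Var → ℝ),
    (∀ v : (pc i).Var, (pc i).near b v → Bt₁ v = Bt₂ v) → (pc i).Cop U Bt₁ b = (pc i).Cop U Bt₂ b

end B9Carve10Thm312toAppCHyp

/-! ## §3 The bundle -/

section Bundle

open B9 B9SectDERandomWalkClauses B9Thm314 B9Carve10Thm312toAppCHyp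

/-- **BLOCK 10 — THE PRINTED STATEMENTS OF pp. 423–434 CONJOINED BY NAME** (hypothesis form, keyed to `stmt-QuantumFields-20542`; a node
prover takes `(h : B9Carve10Thm312toAppCHyp d c35 geo bg 𝔩)` and projects with the dot lemmas of §4, v1.1).  Conjuncts, in page order:
(1) (N1) the common-constants clause pp. 423–424 (`CommonConstantsPrinted`); (2) **Theorem 3.12** p. 423 (`B9.Thm312Printed`, r1's
leaf of record with its abstract slots `HasRWExp`, `HasRWExpH`, `PosDefK`); (3) the statement (3.132) p. 422 for (QGQ*)⁻¹, (QG₁Q*)⁻¹,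
under which Theorem 3.13 is announced («Especially for 𝔊 we have, assuming (3.132)», p. 426) (`B9.Stmt3132Printed`); (4) Theorem
3.12's Theorem-3.10 clauses in printed shape (`Thm312RWPrinted`); (5) **Theorem 3.13** p. 426 (`B9.Thm313Printed`); (6) its
Theorem-3.10 clause (`Thm313RWPrinted`); (7) **Theorem 3.14** pp. 426–427 for every kernel-family-type operator t ∈ 𝔩.T of the member
(«cubes Δ̃(y), Δ̃(y′) in the case of operators G′, G, G₁, 𝔊»; `B9Thm314.Thm314LocalPrinted`, the printed localisation reading —
r1's unrestricted `B9.Thm314Printed` is its OmK ≡ True case by `B9Thm314.thm314Printed_iff_supOn_univ ∘ supOn_of_local`), (8) for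
(Q′G′²Q′*)⁻¹ (`Thm314CinvPrinted`) and (9) for (QGQ*)⁻¹, (QG₁Q*)⁻¹, H, H₁ (`Thm314SectDKernelsPrinted`); (10) (N3) the almost-locality
of the parametrization operator C of B = CB̃, p. 428 (`Remark428CAlmostLocalPrinted`); (11) the γ₀ sentence p. 428 (`ClaimP428GammaZeroPrinted`); (12) p. 431 «(3.174) … implies all
properties of C′^{(k)}(Λ), especially a random walk expansion» (`Thm315RWCorePrinted` at the expansion `ECp` of C′^{(k)}(Λ)); (13)
(N2) the regularity remark after (3.177) (`Remark3177RegularPrinted`); (14) **Theorem 3.15** p. 432 in full (`B9.Thm315FullPrinted`)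
and (15) the verbatim core of its expansion clause for the designated expansion `EC` of C^{(k)}(Λ) (`Thm315RWCorePrinted`).  The
PROVED identities of pp. 424–432 ((3.139)–(3.153), (3.157)–(3.158), (3.160)–(3.186)) and the Appendix's displays are theorems/
definitions of the tree (module docstring) and are not hypotheses.  Nothing asserted.
[cite: Balaban1985BackgroundPropagators, Thms 3.12–3.15 pp.423–432, (3.132)–(3.133) p.422, (3.154) p.427, p.428, (3.174) & (3.177) p.431] -/
def B9Carve10Thm312toAppCHyp {I : Type} (d : ℕ) (c35 : ℝ) (geo : I → Geometry) (bg : I → Backgrounds)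
    (𝔩 : Letters geo bg) : Prop :=
  CommonConstantsPrinted d c35 geo bg 𝔩.Gp 𝔩.GA 𝔩.GD 𝔩.G₁ 𝔩.Cinv 𝔩.QGQinv 𝔩.QG₁Qinv 𝔩.H 𝔩.H₁ ∧
  Thm312Printed d c35 geo bg 𝔩.GD 𝔩.G₁ 𝔩.H 𝔩.H₁ 𝔩.HasRWExp 𝔩.HasRWExpH 𝔩.PosDefK ∧
  Stmt3132Printed d c35 geo bg 𝔩.QGQinv 𝔩.QG₁Qinv ∧
  Thm312RWPrinted d c35 geo bg 𝔩.ED 𝔩.E₁ 𝔩.termD 𝔩.term₁ 𝔩.EH 𝔩.EH₁ 𝔩.termH 𝔩.termH₁ ∧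
  Thm313Printed c35 geo bg 𝔩.GG 𝔩.HasRWExp 𝔩.PosDefK ∧
  Thm313RWPrinted c35 geo bg 𝔩.EG 𝔩.termG ∧
  (∀ t : 𝔩.T, Thm314LocalPrinted c35 geo bg (𝔩.Kdiff t) 𝔩.OmK 𝔩.dOmega) ∧
  Thm314CinvPrinted d c35 geo bg 𝔩.Cdiff 𝔩.OmK 𝔩.dOmega ∧
  Thm314SectDKernelsPrinted d c35 geo bg 𝔩.Qdiff 𝔩.Q₁diff 𝔩.Hdiff 𝔩.H₁diff 𝔩.OmK 𝔩.dOmega ∧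
  Remark428CAlmostLocalPrinted bg 𝔩.paramC ∧
  ClaimP428GammaZeroPrinted c35 geo bg 𝔩.Coercive ∧
  Thm315RWCorePrinted c35 geo bg 𝔩.ECp ∧
  Remark3177RegularPrinted c35 geo bg 𝔩.hprime ∧
  Thm315FullPrinted c35 geo bg 𝔩.Ck 𝔩.inΛ 𝔩.unitDist 𝔩.GivenBy3185 𝔩.HasRWExpC ∧
  Thm315RWCorePrinted c35 geo bg 𝔩.EC

end Bundle

/-! ## §4 Bookkeeping (kernel-checked): projections, and the common-constants clause implies the separately typed theorems -/

namespace B9Carve10Thm312toAppCHyp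

open B9 B9SectDERandomWalkClauses B9Thm314

section CommonConstants

variable {I : Type} {d : ℕ} {c35 : ℝ} {geo : I → Geometry} {bg : I → Backgrounds}
  {Gp GA GD G₁ : ∀ i, KernelFamily (geo i) (bg i)} {Cinv QGQinv QG₁Qinv : ∀ i, SiteKernel (geo i) (bg i)}
  {H H₁ : ∀ i, HKernel (geo i) (bg i)}

/-- (N1) ⟹ r1's **Theorem 3.1** for G′ (the common constants serve Theorem 3.1's blocks). [cite: Balaban1985BackgroundPropagators, pp.423–424 + Thm 3.1 pp.397–398 (bookkeeping)] -/
theorem CommonConstantsPrinted.thm31 (h : CommonConstantsPrinted d c35 geo bg Gp GA GD G₁ Cinv QGQinv QG₁Qinv H H₁) :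
    Thm31Printed c35 geo bg Gp := by
  obtain ⟨M₀, δ₀, a₀, B₀, Bβ, Bε, Bεβ, hM, hδ, ha, hB, hall⟩ := h
  exact ⟨M₀, δ₀, a₀, B₀, Bβ, Bε, Bεβ, hM, hδ, ha, hB,
    fun i hMi α₀ hα hMa U hU => (hall i hMi α₀ hα hMa U hU).1.1⟩

/-- (N1) ⟹ r1's **Theorem 3.2** for (Q′G′²Q′*)⁻¹, (3.48). [cite: Balaban1985BackgroundPropagators, pp.423–424 + Thm 3.2 (3.48) p.398 (bookkeeping)] -/
theorem CommonConstantsPrinted.thm32 (h : CommonConstantsPrinted d c35 geo bg Gp GA GD G₁ Cinv QGQinv QG₁Qinv H H₁) :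
    Thm32Printed d c35 geo bg Cinv := by
  obtain ⟨M₀, δ₀, a₀, B₀, Bβ, Bε, Bεβ, hM, hδ, ha, hB, hall⟩ := h
  exact ⟨M₀, δ₀, a₀, B₀, hM, hδ, ha, hB,
    fun i hMi α₀ hα hMa U hU => (hall i hMi α₀ hα hMa U hU).1.2.1⟩

/-- (N1) ⟹ r1's jointly typed **Theorems 3.1 + 3.2** («with the same constants», `B9.Thm31and32Printed`). [cite: Balaban1985BackgroundPropagators, pp.423–424 + Thms 3.1–3.2 pp.397–398 (bookkeeping)] -/
theorem CommonConstantsPrinted.thm31and32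
    (h : CommonConstantsPrinted d c35 geo bg Gp GA GD G₁ Cinv QGQinv QG₁Qinv H H₁) :
    Thm31and32Printed d c35 geo bg Gp Cinv := by
  obtain ⟨M₀, δ₀, a₀, B₀, Bβ, Bε, Bεβ, hM, hδ, ha, hB, hall⟩ := h
  refine ⟨M₀, δ₀, a₀, B₀, Bβ, Bε, Bεβ, hM, hδ, ha, hB, fun i hMi α₀ hα hMa U hU => ?_⟩
  have h1 := (hall i hMi α₀ hα hMa U hU).1
  exact ⟨h1.1.1, h1.1.2, h1.2.1⟩

/-- (N1) ⟹ r1's **Theorem 3.3** (G′ and the Sect. A–C operator G with the constants of Theorem 3.1). [cite: Balaban1985BackgroundPropagators, pp.423–424 + Thm 3.3 p.399 (bookkeeping)] -/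
theorem CommonConstantsPrinted.thm33 (h : CommonConstantsPrinted d c35 geo bg Gp GA GD G₁ Cinv QGQinv QG₁Qinv H H₁) :
    Thm33Printed c35 geo bg Gp GA := by
  obtain ⟨M₀, δ₀, a₀, B₀, Bβ, Bε, Bεβ, hM, hδ, ha, hB, hall⟩ := h
  refine ⟨M₀, δ₀, a₀, B₀, Bβ, Bε, Bεβ, hM, hδ, ha, hB, fun i hMi α₀ hα hMa U hU => ?_⟩
  have h1 := (hall i hMi α₀ hα hMa U hU).1
  exact ⟨h1.1, h1.2.2⟩

/-- (N1) ⟹ r1's statement **(3.132)** for (QGQ*)⁻¹ and (QG₁Q*)⁻¹ (`B9.Stmt3132Printed`, with δ₁ := the common δ₀). [cite: Balaban1985BackgroundPropagators, pp.423–424 + (3.132) p.422 (bookkeeping)] -/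
theorem CommonConstantsPrinted.stmt3132
    (h : CommonConstantsPrinted d c35 geo bg Gp GA GD G₁ Cinv QGQinv QG₁Qinv H H₁) :
    Stmt3132Printed d c35 geo bg QGQinv QG₁Qinv := by
  obtain ⟨M₀, δ₀, a₀, B₀, Bβ, Bε, Bεβ, hM, hδ, ha, hB, hall⟩ := h
  exact ⟨M₀, δ₀, a₀, B₀, hM, hδ, ha, hB,
    fun i hMi α₀ hα hMa U hU hU' => ((hall i hMi α₀ hα hMa U hU).2 hU').2.2.2⟩

/-- (N1) ⟹ the INEQUALITY BLOCKS of **Theorem 3.12** for G, G₁, H, H₁ with ONE set of constants (the part of `B9.Thm312Printed`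
without its abstract slots `HasRWExp`, `HasRWExpH`, `PosDefK`, which (N1) does not carry). [cite: Balaban1985BackgroundPropagators, pp.423–424 + Thm 3.12 p.423 (bookkeeping)] -/
theorem CommonConstantsPrinted.sectD_blocks
    (h : CommonConstantsPrinted d c35 geo bg Gp GA GD G₁ Cinv QGQinv QG₁Qinv H H₁) :
    ∃ M₀ δ₀ a₀ B₀ : ℝ, ∃ Bβ Bε : ℝ → ℝ, ∃ Bεβ : ℝ → ℝ → ℝ, 0 < M₀ ∧ 0 < δ₀ ∧ 0 < a₀ ∧ 0 < B₀ ∧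
      ∀ i : I, M₀ ≤ (geo i).M → ∀ α₀ : ℝ, 0 < α₀ → (geo i).M * α₀ ≤ a₀ →
        ∀ U : (bg i).Cfg, (bg i).Reg335 c35 α₀ U → (bg i).Reg336 c35 α₀ U →
          (Ineq342_346_347_noLap (GD i) B₀ δ₀ U ∧ Ineq343_345 (GD i) Bβ Bε Bεβ δ₀ U) ∧
          (Ineq342_346_347_noLap (G₁ i) B₀ δ₀ U ∧ Ineq343_345 (G₁ i) Bβ Bε Bεβ δ₀ U) ∧
          (Ineq3133 d (H i) B₀ Bβ δ₀ U ∧ Ineq3133 d (H₁ i) B₀ Bβ δ₀ U) := by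
  obtain ⟨M₀, δ₀, a₀, B₀, Bβ, Bε, Bεβ, hM, hδ, ha, hB, hall⟩ := h
  refine ⟨M₀, δ₀, a₀, B₀, Bβ, Bε, Bεβ, hM, hδ, ha, hB, fun i hMi α₀ hα hMa U hU hU' => ?_⟩
  have h2 := (hall i hMi α₀ hα hMa U hU).2 hU'
  exact ⟨h2.1, h2.2.1, h2.2.2.1⟩

end CommonConstants

section Projections

variable {I : Type} {d : ℕ} {c35 : ℝ} {geo : I → Geometry} {bg : I → Backgrounds} {𝔩 : Letters geo bg}

/-- Projection: the common-constants clause (N1). [cite: Balaban1985BackgroundPropagators, pp.423–424 (bookkeeping)] -/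
theorem common (h : B9Carve10Thm312toAppCHyp d c35 geo bg 𝔩) :
    CommonConstantsPrinted d c35 geo bg 𝔩.Gp 𝔩.GA 𝔩.GD 𝔩.G₁ 𝔩.Cinv 𝔩.QGQinv 𝔩.QG₁Qinv 𝔩.H 𝔩.H₁ := h.1

/-- Projection: **Theorem 3.12** as r1's leaf `B9.Thm312Printed`. [cite: Balaban1985BackgroundPropagators, Thm 3.12 p.423 (bookkeeping)] -/
theorem thm312 (h : B9Carve10Thm312toAppCHyp d c35 geo bg 𝔩) :
    Thm312Printed d c35 geo bg 𝔩.GD 𝔩.G₁ 𝔩.H 𝔩.H₁ 𝔩.HasRWExp 𝔩.HasRWExpH 𝔩.PosDefK := h.2.1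

/-- Projection: the statement (3.132). [cite: Balaban1985BackgroundPropagators, (3.132) p.422 (bookkeeping)] -/
theorem stmt3132 (h : B9Carve10Thm312toAppCHyp d c35 geo bg 𝔩) :
    Stmt3132Printed d c35 geo bg 𝔩.QGQinv 𝔩.QG₁Qinv := h.2.2.1

/-- Projection: Theorem 3.12's random-walk clauses. [cite: Balaban1985BackgroundPropagators, Thm 3.12 p.423, remark p.427 (bookkeeping)] -/
theorem rw312 (h : B9Carve10Thm312toAppCHyp d c35 geo bg 𝔩) :
    Thm312RWPrinted d c35 geo bg 𝔩.ED 𝔩.E₁ 𝔩.termD 𝔩.term₁ 𝔩.EH 𝔩.EH₁ 𝔩.termH 𝔩.termH₁ := h.2.2.2.1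

/-- Projection: **Theorem 3.13** as r1's leaf `B9.Thm313Printed`. [cite: Balaban1985BackgroundPropagators, Thm 3.13 p.426 (bookkeeping)] -/
theorem thm313 (h : B9Carve10Thm312toAppCHyp d c35 geo bg 𝔩) :
    Thm313Printed c35 geo bg 𝔩.GG 𝔩.HasRWExp 𝔩.PosDefK := h.2.2.2.2.1

/-- Projection: Theorem 3.13's random-walk clause. [cite: Balaban1985BackgroundPropagators, Thm 3.13 p.426 (bookkeeping)] -/
theorem rw313 (h : B9Carve10Thm312toAppCHyp d c35 geo bg 𝔩) :
    Thm313RWPrinted c35 geo bg 𝔩.EG 𝔩.termG := h.2.2.2.2.2.1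

/-- Projection: **Theorem 3.14** for the kernel-family-type operator `t` (printed localisation reading). [cite: Balaban1985BackgroundPropagators, Thm 3.14 (3.154) pp.426–427 (bookkeeping)] -/
theorem thm314 (h : B9Carve10Thm312toAppCHyp d c35 geo bg 𝔩) (t : 𝔩.T) :
    Thm314LocalPrinted c35 geo bg (𝔩.Kdiff t) 𝔩.OmK 𝔩.dOmega := h.2.2.2.2.2.2.1 t

/-- Projection: Theorem 3.14 for the operator `t` in r1's UNRESTRICTED sup-entry form `B9.Thm314Printed`, when the member's
localisation predicate is trivially true (`B9Thm314.supOn_of_local`, `thm314Printed_iff_supOn_univ`). [cite: Balaban1985BackgroundPropagators, Thm 3.14 pp.426–427 (bookkeeping)] -/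
theorem thm314_r1 (h : B9Carve10Thm312toAppCHyp d c35 geo bg 𝔩) (hOm : 𝔩.OmK = fun _ _ => True) (t : 𝔩.T) :
    Thm314Printed c35 geo bg (𝔩.Kdiff t) 𝔩.dOmega := by
  have hloc := h.thm314 t
  rw [hOm] at hloc
  exact thm314Printed_iff_supOn_univ.mpr (supOn_of_local hloc)

/-- Projection: Theorem 3.14 for (Q′G′²Q′*)⁻¹. [cite: Balaban1985BackgroundPropagators, Thm 3.14 pp.426–427, (3.48) p.398 (bookkeeping)] -/
theorem thm314Cinv (h : B9Carve10Thm312toAppCHyp d c35 geo bg 𝔩) :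
    Thm314CinvPrinted d c35 geo bg 𝔩.Cdiff 𝔩.OmK 𝔩.dOmega := h.2.2.2.2.2.2.2.1

/-- Projection: Theorem 3.14 for (QGQ*)⁻¹, (QG₁Q*)⁻¹, H, H₁. [cite: Balaban1985BackgroundPropagators, Thm 3.14 pp.426–427, (3.132)–(3.133) p.422 (bookkeeping)] -/
theorem thm314SectD (h : B9Carve10Thm312toAppCHyp d c35 geo bg 𝔩) :
    Thm314SectDKernelsPrinted d c35 geo bg 𝔩.Qdiff 𝔩.Q₁diff 𝔩.Hdiff 𝔩.H₁diff 𝔩.OmK 𝔩.dOmega :=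
  h.2.2.2.2.2.2.2.2.1

/-- Projection: (N3) the almost-locality of C, p. 428. [cite: Balaban1985BackgroundPropagators, p.428 (bookkeeping)] -/
theorem almostLocalC (h : B9Carve10Thm312toAppCHyp d c35 geo bg 𝔩) : Remark428CAlmostLocalPrinted bg 𝔩.paramC :=
  h.2.2.2.2.2.2.2.2.2.1

/-- Projection: the γ₀ sentence of p. 428. [cite: Balaban1985BackgroundPropagators, p.428 (bookkeeping)] -/
theorem gamma0 (h : B9Carve10Thm312toAppCHyp d c35 geo bg 𝔩) :
    ClaimP428GammaZeroPrinted c35 geo bg 𝔩.Coercive := h.2.2.2.2.2.2.2.2.2.2.1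

/-- Projection: p. 431 «(3.174) … It implies all properties of C′^{(k)}(Λ), especially a random walk expansion» — the convergent,
localized expansion `ECp` of C′^{(k)}(Λ). [cite: Balaban1985BackgroundPropagators, (3.174) p.431 (bookkeeping)] -/
theorem rwCprime (h : B9Carve10Thm312toAppCHyp d c35 geo bg 𝔩) :
    Thm315RWCorePrinted c35 geo bg 𝔩.ECp := h.2.2.2.2.2.2.2.2.2.2.2.1

/-- Projection: (N2) the regularity remark after (3.177). [cite: Balaban1985BackgroundPropagators, (3.177) p.431 (bookkeeping)] -/
theorem reg3177 (h : B9Carve10Thm312toAppCHyp d c35 geo bg 𝔩) :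
    Remark3177RegularPrinted c35 geo bg 𝔩.hprime := h.2.2.2.2.2.2.2.2.2.2.2.2.1

/-- Projection: **Theorem 3.15** in full (`B9.Thm315FullPrinted`). [cite: Balaban1985BackgroundPropagators, Thm 3.15 (3.185)–(3.187) p.432 (bookkeeping)] -/
theorem thm315Full (h : B9Carve10Thm312toAppCHyp d c35 geo bg 𝔩) :
    Thm315FullPrinted c35 geo bg 𝔩.Ck 𝔩.inΛ 𝔩.unitDist 𝔩.GivenBy3185 𝔩.HasRWExpC := h.2.2.2.2.2.2.2.2.2.2.2.2.2.1

/-- Projection: Theorem 3.15's bound (3.187) alone, r1's `B9.Thm315Printed` (via `B9.thm315_bound_of_full`). [cite: Balaban1985BackgroundPropagators, Thm 3.15 (3.187) p.432 (bookkeeping)] -/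
theorem thm315 (h : B9Carve10Thm312toAppCHyp d c35 geo bg 𝔩) :
    Thm315Printed c35 geo bg 𝔩.Ck 𝔩.inΛ 𝔩.unitDist :=
  thm315_bound_of_full c35 geo bg 𝔩.Ck 𝔩.inΛ 𝔩.unitDist 𝔩.GivenBy3185 𝔩.HasRWExpC h.thm315Full

/-- Projection: the verbatim core of Theorem 3.15's expansion clause for the expansion `EC` of C^{(k)}(Λ). [cite: Balaban1985BackgroundPropagators, Thm 3.15 p.432 (bookkeeping)] -/
theorem rw315core (h : B9Carve10Thm312toAppCHyp d c35 geo bg 𝔩) :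
    Thm315RWCorePrinted c35 geo bg 𝔩.EC := h.2.2.2.2.2.2.2.2.2.2.2.2.2.2

/-- Derived: **Theorem 3.1** for G′ from the bundle (through (N1)). [cite: Balaban1985BackgroundPropagators, Thm 3.1 pp.397–398 + pp.423–424 (bookkeeping)] -/
theorem thm31 (h : B9Carve10Thm312toAppCHyp d c35 geo bg 𝔩) : Thm31Printed c35 geo bg 𝔩.Gp := h.common.thm31

/-- Derived: **Theorem 3.2** for (Q′G′²Q′*)⁻¹ from the bundle (through (N1)). [cite: Balaban1985BackgroundPropagators, Thm 3.2 (3.48) p.398 + pp.423–424 (bookkeeping)] -/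
theorem thm32 (h : B9Carve10Thm312toAppCHyp d c35 geo bg 𝔩) : Thm32Printed d c35 geo bg 𝔩.Cinv := h.common.thm32

/-- Derived: **Theorem 3.3** for G′ and the Sect. A–C operator G from the bundle (through (N1)). [cite: Balaban1985BackgroundPropagators, Thm 3.3 p.399 + pp.423–424 (bookkeeping)] -/
theorem thm33 (h : B9Carve10Thm312toAppCHyp d c35 geo bg 𝔩) : Thm33Printed c35 geo bg 𝔩.Gp 𝔩.GA := h.common.thm33

end Projections

end B9Carve10Thm312toAppCHyp

/-! ## §5 (v1.2, APPEND-ONLY) Interface alignment and the uniform-locality variant — check-5's notes N-c5-1, N-c5-5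
(`carve/CHECK-5.md` 2026-08-28T06:09:30Z, PASS-WITH-NOTES) and reviewer note (b) of p607801 -/

namespace B9Carve10Thm312toAppCHyp

open B9 B9SectDERandomWalkClauses B9Thm314

/-- **THE FAN'S NAME FOR THE BUNDLE** (N-c5-1): `B9Carve10Thm312toAppCHyp.Hyp` — the shape `<Stem>.Hyp` of the sibling carve files
(`B9Carve06Thms31to34Hyp.Hyp`, …) and of `carve/CARVE-LIST.md` § Block 10 — as a reducible alias of the bundle
`…Balaban1983to89.B9Carve10Thm312toAppCHyp` (which keeps its name for the dot-notation projections of §4).  Same Prop, by `Iff.rfl`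
(`hyp_iff`); a node prover may take either spelling. [cite: Balaban1985BackgroundPropagators, Thms 3.12–3.15 pp.423–432 (bookkeeping)] -/
abbrev Hyp {I : Type} (d : ℕ) (c35 : ℝ) (geo : I → Geometry) (bg : I → Backgrounds) (𝔩 : Letters geo bg) : Prop :=
  B9Carve10Thm312toAppCHyp d c35 geo bg 𝔩

/-- The alias is the bundle (definitional). [cite: Balaban1985BackgroundPropagators, Thms 3.12–3.15 pp.423–432 (bookkeeping)] -/
theorem hyp_iff {I : Type} {d : ℕ} {c35 : ℝ} {geo : I → Geometry} {bg : I → Backgrounds} {𝔩 : Letters geo bg} :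
    Hyp d c35 geo bg 𝔩 ↔ B9Carve10Thm312toAppCHyp d c35 geo bg 𝔩 := Iff.rfl

/-- **(N3′) THE ALMOST-LOCALITY OF C WITH A UNIFORM RADIUS** (N-c5-5's sharper shape of p. 428 «a value (CB̃)(b) depends on B̃
restricted to several blocks surrounding the bond b»): with a block-distance letter `bdist i b v` (the distance, in blocks of the
unit lattice, from the bond b to the B̃-variable v — supplied by the member, like `near`) there is ONE radius r > 0 BEFORE the member i
such that (CB̃)(b) depends only on B̃ restricted to {v : bdist b v ≤ r}.  READING («several blocks» ↦ a radius r independent of k, U,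
Λ — the uniformity Sect. E's estimates consume, cf. the locality range r of `B9Thm315Decay.Rep3185`); hypothesis slot, never
asserted; implies (N3) for the neighbourhoods `near b v := bdist b v ≤ r` (`almostLocal_of_uniform`).
[cite: Balaban1985BackgroundPropagators, p.428 (after (3.156))] -/
def Remark428CAlmostLocalUniformPrinted {I : Type} (bg : I → Backgrounds) (pc : ∀ i, ParamCLetters (bg i))
    (bdist : ∀ i, (pc i).Bond → (pc i).Var → ℝ) : Prop :=
  ∃ r : ℝ, 0 < r ∧ ∀ i : I, ∀ U : (bg i).Cfg, ∀ (b : (pc i).Bond) (Bt₁ Bt₂ : (pc i).Var → ℝ),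
    (∀ v : (pc i).Var, bdist i b v ≤ r → Bt₁ v = Bt₂ v) → (pc i).Cop U Bt₁ b = (pc i).Cop U Bt₂ b

/-- Bookkeeping (kernel-checked): the uniform-radius reading (N3′) gives (N3) for the letters whose neighbourhood `near b v` is the
r-ball `bdist b v ≤ r` (all other letters unchanged). [cite: Balaban1985BackgroundPropagators, p.428 (bookkeeping)] -/
theorem almostLocal_of_uniform {I : Type} {bg : I → Backgrounds} {pc : ∀ i, ParamCLetters (bg i)}
    {bdist : ∀ i, (pc i).Bond → (pc i).Var → ℝ} (h : Remark428CAlmostLocalUniformPrinted bg pc bdist) :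
    ∃ r : ℝ, 0 < r ∧
      Remark428CAlmostLocalPrinted bg (fun i => { pc i with near := fun b v => bdist i b v ≤ r }) := by
  obtain ⟨r, hr, hall⟩ := h
  exact ⟨r, hr, fun i U b Bt₁ Bt₂ hagree => hall i U b Bt₁ Bt₂ hagree⟩

/-- Bookkeeping (kernel-checked): conversely, (N3) for letters whose neighbourhoods are contained in r-balls of `bdist` for ONE r > 0
(before the member) is the uniform reading (N3′). [cite: Balaban1985BackgroundPropagators, p.428 (bookkeeping)] -/
theorem uniform_of_almostLocal {I : Type} {bg : I → Backgrounds} {pc : ∀ i, ParamCLetters (bg i)}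
    {bdist : ∀ i, (pc i).Bond → (pc i).Var → ℝ} {r : ℝ} (hr : 0 < r)
    (hball : ∀ i (b : (pc i).Bond) (v : (pc i).Var), (pc i).near b v → bdist i b v ≤ r)
    (h : Remark428CAlmostLocalPrinted bg pc) : Remark428CAlmostLocalUniformPrinted bg pc bdist :=
  ⟨r, hr, fun i U b Bt₁ Bt₂ hagree => h i U b Bt₁ Bt₂ fun v hv => hagree v (hball i b v hv)⟩

/-- Projection through the alias: a consumer holding `h : Hyp …` gets Theorem 3.12 (and every other §4 projection) by the same dot
names after `hyp_iff`, e.g. this one. [cite: Balaban1985BackgroundPropagators, Thm 3.12 p.423 (bookkeeping)] -/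
theorem Hyp.thm312 {I : Type} {d : ℕ} {c35 : ℝ} {geo : I → Geometry} {bg : I → Backgrounds} {𝔩 : Letters geo bg}
    (h : Hyp d c35 geo bg 𝔩) :
    Thm312Printed d c35 geo bg 𝔩.GD 𝔩.G₁ 𝔩.H 𝔩.H₁ 𝔩.HasRWExp 𝔩.HasRWExpH 𝔩.PosDefK :=
  B9Carve10Thm312toAppCHyp.thm312 h

/-- Projection through the alias: Theorem 3.15 in full. [cite: Balaban1985BackgroundPropagators, Thm 3.15 p.432 (bookkeeping)] -/
theorem Hyp.thm315Full {I : Type} {d : ℕ} {c35 : ℝ} {geo : I → Geometry} {bg : I → Backgrounds} {𝔩 : Letters geo bg}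
    (h : Hyp d c35 geo bg 𝔩) :
    Thm315FullPrinted c35 geo bg 𝔩.Ck 𝔩.inΛ 𝔩.unitDist 𝔩.GivenBy3185 𝔩.HasRWExpC :=
  B9Carve10Thm312toAppCHyp.thm315Full h

end B9Carve10Thm312toAppCHyp

end Literature.MathematicalPhysics.QuantumFieldTheory.Balaban1983to89
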